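import Summits.CriticalPhenomena.SAWScalingLimit.Theorems.SAWDevelopingMapHexConjectureKPCountA
import HarnessLib

/-!
# Crux `HexConjecture` (stmt-CriticalPhenomena-0808), line `root-locality-replaces-loewner`:
Krachun–Panagiotis Lemma 3.3, the multiplicity of the three-piece gluing (helper file)

Landing target:
`Summits/CriticalPhenomena/SAWScalingLimit/Theorems/SAWDevelopingMapHexConjectureKPCountBAux.lean`
(`--supports stmt-CriticalPhenomena-0808`; helper file of the registered stub `stub_kp_countB`,
registered helper theorem `stub_kp_countB_cuts`).

The counting step of [KP, proof of Lemma 3.3] ("Arguing as in the proof of Lemma 3.2 we see that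
there are at most `max_k M_k` choices for `γ₁` and at most `max_i M_i` choices for `γ₂`") rests on
the two facts about cutting a concatenation `γ = γ₁ ∘ (rest)` at a slanted level proved for
Lemma 3.2 in `…KPCountA.lean`: with `P, P' ∈ rightWalks k` the cut at level `k` is unique
(`kpCount_prefix_eq`), and with `P' ∈ rightWalks k'`, `k' ≤ k`, the rest beyond the line
`slev = k' ∣ k'+1`, the level `k'` is a renewal time of `P` (`kpCount_crossCount_eq_one`) — restated
together as the registered conjunction `stub_kp_countB_cuts`.  Here they are applied twice to the
glued list `γ₁ ++ (φ γ₂).drop 2 ++ (φ ψ γ₃).drop 2` of construction (b) (the placements `φ = A γ₁`,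
`ψ = A γ₂` any automorphisms read off the pieces): to the first piece (`kpCountB_cut₁`,
`kpCountB_ren₁`) and, the first piece being known, to the second piece inside the pulled-back
remainder `σ = γ₂ ++ (ψ γ₃).drop 2` (`kpCountB_cut₂`; "`k` is a renewal time of `γ ∈ F^R_{2i+1,x}`
if it is a renewal time of `e^{πi/3}(γ - x)`", [KP, proof of Lemma 3.2]).  The abstract two-level
counting principle `kpCountB_card_le_mul` (a finite set indexed injectively by two levels `(k, i)`,
the valid `k`'s inside a set of size `≤ M₁` attached to the top element and, `k` fixed, the valid
`i`'s inside a set of size `≤ M₂`, has at most `M₁ M₂` elements) closes the argument in the main file.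
-/

noncomputable section

open scoped Classical
open Finset
open Literature.Probability.RandomPlanarGeometry.SAW Literature.Probability.RandomPlanarGeometry.SAW.HV

namespace Summit.CriticalPhenomena.SAWScalingLimit.Theorems.HexConjecture.RootLocality

/-! ### The two-level multiplicity bound -/

/-- **Two-level multiplicity bound**: a finite set `F` carries two indices `κ` ("the scale `k` of
`γ₁`") and `ι` ("the scale `i` of `γ₂`") determining its elements; if every `κ`-value below `κ t`
lies in a set `R₁ t` of size `≤ M₁` (the renewal times of `γ₁`), and, at fixed `κ`, every `ι`-value
below `ι t` lies in a set `R₂ t` of size `≤ M₂` (the renewal times of `γ₂`), then `|F| ≤ M₁ M₂`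
("at most `max_k M_k` choices for `γ₁` and at most `max_i M_i` choices for `γ₂`").
[cite: KrachunPanagiotis2026, proof of Lemma 3.3] -/
theorem kpCountB_card_le_mul {α : Type*} (F : Finset α) (κ ι : α → ℕ) (R₁ R₂ : α → Finset ℕ)
    {M₁ M₂ : ℝ} (h0₁ : 0 ≤ M₁) (h0₂ : 0 ≤ M₂)
    (h1 : ∀ t ∈ F, ∀ t' ∈ F, κ t' ≤ κ t → κ t' ∈ R₁ t) (h2 : ∀ t ∈ F, ((R₁ t).card : ℝ) ≤ M₁)
    (h3 : ∀ t ∈ F, ∀ t' ∈ F, κ t' = κ t → ι t' ≤ ι t → ι t' ∈ R₂ t)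
    (h4 : ∀ t ∈ F, ((R₂ t).card : ℝ) ≤ M₂)
    (h5 : ∀ t ∈ F, ∀ t' ∈ F, κ t' = κ t → ι t' = ι t → t' = t) :
    (F.card : ℝ) ≤ M₁ * M₂ := by
  -- the valid first indices sit among the `R₁` of the element with the largest one
  have hK : ((F.image κ).card : ℝ) ≤ M₁ := by
    rcases F.eq_empty_or_nonempty with rfl | hne
    · simpa using h0₁
    obtain ⟨t₀, ht₀, hmax⟩ := F.exists_max_image κ hne
    have hsub : F.image κ ⊆ R₁ t₀ := by
      intro k hk
      obtain ⟨t', ht', rfl⟩ := mem_image.1 hk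
      exact h1 t₀ ht₀ t' ht' (hmax t' ht')
    exact (Nat.cast_le.2 (card_le_card hsub)).trans (h2 t₀ ht₀)
  -- at fixed first index the second index is injective with values among an `R₂`
  have hfib : ∀ k ∈ F.image κ, (((F.filter fun t => κ t = k).card : ℕ) : ℝ) ≤ M₂ := by
    intro k hk
    obtain ⟨t₁, ht₁, rfl⟩ := mem_image.1 hk
    obtain ⟨t₀, ht₀, hmax⟩ :=
      (F.filter fun t => κ t = κ t₁).exists_max_image ι ⟨t₁, mem_filter.2 ⟨ht₁, rfl⟩⟩
    have ht₀' := mem_filter.1 ht₀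
    have hinj : Set.InjOn ι ↑(F.filter fun t => κ t = κ t₁) := by
      intro t ht t' ht' h
      have ht₁ := mem_filter.1 (mem_coe.1 ht)
      have ht₂ := mem_filter.1 (mem_coe.1 ht')
      exact (h5 t ht₁.1 t' ht₂.1 (ht₂.2.trans ht₁.2.symm) h.symm).symm
    rw [← card_image_of_injOn hinj]
    have hsub : (F.filter fun t => κ t = κ t₁).image ι ⊆ R₂ t₀ := by
      intro j hj
      obtain ⟨t', ht', rfl⟩ := mem_image.1 hj
      have ht'' := mem_filter.1 ht'
      exact h3 t₀ ht₀'.1 t' ht''.1 (ht''.2.trans ht₀'.2.symm) (hmax t' ht')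
    exact (Nat.cast_le.2 (card_le_card hsub)).trans (h4 t₀ ht₀'.1)
  calc (F.card : ℝ) = ∑ k ∈ F.image κ, (((F.filter fun t => κ t = k).card : ℕ) : ℝ) := by
        rw [card_eq_sum_card_image κ F]
        push_cast
        rfl
    _ ≤ ∑ k ∈ F.image κ, M₂ := sum_le_sum hfib
    _ = (F.image κ).card * M₂ := by rw [sum_const, nsmul_eq_mul]
    _ ≤ M₁ * M₂ := mul_le_mul_of_nonneg_right hK h0₂

/-! ### The glued list of construction (b) and the pulled-back remainder `σ` -/

/-- Two lists `a :: b :: S`, `a :: b :: S'` whose images under an injective map agree after the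
first two entries are equal. [folklore] -/
theorem kpCountB_eq_of_map_drop_two {α β : Type*} {f : α → β} (hf : Function.Injective f)
    {a b : α} {S S' : List α}
    (h : ((a :: b :: S).map f).drop 2 = ((a :: b :: S').map f).drop 2) : S = S' := by
  simp only [List.map_cons, List.drop_succ_cons, List.drop_zero] at h
  exact List.map_injective_iff.2 hf h

/-- Mapping `σ = γ₂ ++ (ψ γ₃).drop 2` and dropping the root dart gives the last two placed pieces.
[folklore] -/
theorem kpCountB_sig_map_drop {V : Finset HV} {P₂ : List HV} (hP₂ : P₂ ∈ midWalks V)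
    (P₃ : List HV) (ψ φ : hvGraph ≃g hvGraph) :
    ((P₂ ++ (P₃.map ψ).drop 2).map φ).drop 2 = (P₂.map φ).drop 2 ++ ((P₃.map ψ).map φ).drop 2 := by
  have h2 : 2 ≤ (P₂.map φ).length := by
    rw [List.length_map]
    exact (mem_midWalks_iff.1 hP₂).two_le_length
  rw [List.map_append, List.map_drop, List.drop_append_of_le_length h2]

/-- **The glued list via `σ`**: `γ₁ ++ (φ γ₂).drop 2 ++ (φ ψ γ₃).drop 2 = γ₁ ++ (φ σ).drop 2`
("`e^{πi/3}(γ - x)`": the remainder after `γ₁`, pulled back to the frame of `γ₂`, is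
`σ = γ₂ ++ (ψ γ₃).drop 2`). [cite: KrachunPanagiotis2026, proof of Lemma 3.2 (e^{πi/3}(γ − x))] -/
theorem kpCountB_glue_eq {V : Finset HV} {P₂ : List HV} (hP₂ : P₂ ∈ midWalks V) (P₁ P₃ : List HV)
    (ψ φ : hvGraph ≃g hvGraph) :
    P₁ ++ (P₂.map φ).drop 2 ++ ((P₃.map ψ).map φ).drop 2 =
      P₁ ++ ((P₂ ++ (P₃.map ψ).drop 2).map φ).drop 2 := by
  rw [kpCountB_sig_map_drop hP₂, List.append_assoc]

/-- `σ` starts with the root dart `w, O`. [folklore] -/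
theorem kpCountB_sig_eq_cons {V : Finset HV} {P₂ : List HV} (hP₂ : P₂ ∈ midWalks V) (D : List HV) :
    ∃ S, P₂ ++ D = wOut :: hvOrigin :: S := by
  obtain ⟨Q, hQ⟩ := (mem_midWalks_iff.1 hP₂).exists_eq_cons
  subst hQ
  exact ⟨_, rfl⟩

/-! ### Pre-images of the glued list

The placements are read off the pieces by an arbitrary assignment `A` (in the application,
`A P = attach x₀ x₁` at the final dart `((x₀,x₁,false), (x₀,x₁,true))` of `P`). -/

/-- **Same first scale, same glued list ⇒ same first piece and same `σ`** (`kpCount_prefix_eq` for the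
first piece, injectivity of `φ` for `σ`). [cite: KrachunPanagiotis2026, proof of Lemma 3.2–3.3 (pre-images of the concatenation)] -/
theorem kpCountB_cut₁ {A : List HV → hvGraph ≃g hvGraph} {k : ℕ} {V V' : Finset HV}
    {P₁ P₁' P₂ P₂' P₃ P₃' : List HV}
    (hP₁ : P₁ ∈ rightWalks k) (hP₁' : P₁' ∈ rightWalks k) (hP₂ : P₂ ∈ midWalks V)
    (hP₂' : P₂' ∈ midWalks V')
    (h : P₁ ++ (P₂.map (A P₁)).drop 2 ++ ((P₃.map (A P₂)).map (A P₁)).drop 2 =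
      P₁' ++ (P₂'.map (A P₁')).drop 2 ++ ((P₃'.map (A P₂')).map (A P₁')).drop 2) :
    P₁ = P₁' ∧ P₂ ++ (P₃.map (A P₂)).drop 2 = P₂' ++ (P₃'.map (A P₂')).drop 2 := by
  rw [kpCountB_glue_eq hP₂, kpCountB_glue_eq hP₂'] at h
  obtain ⟨rfl, h2⟩ := kpCount_prefix_eq hP₁ hP₁' h
  refine ⟨rfl, ?_⟩
  obtain ⟨S, hS⟩ := kpCountB_sig_eq_cons hP₂ ((P₃.map (A P₂)).drop 2)
  obtain ⟨S', hS'⟩ := kpCountB_sig_eq_cons hP₂' ((P₃'.map (A P₂')).drop 2)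
  rw [hS, hS'] at h2 ⊢
  rw [kpCountB_eq_of_map_drop_two (A P₁).injective h2]

/-- **Same scales, same `σ` ⇒ same second and third pieces** (so `(k, i)` determines the
pre-image: `kpCount_prefix_eq` for the second piece at level `i`, `kpCount_piece₂_eq` for the third).
[cite: KrachunPanagiotis2026, proof of Lemma 3.2–3.3 (pre-images of the concatenation)] -/
theorem kpCountB_cut₂ {A : List HV → hvGraph ≃g hvGraph} {i r r' : ℕ} {P₂ P₂' P₃ P₃' : List HV}
    (hP₂ : P₂ ∈ rightWalks i) (hP₂' : P₂' ∈ rightWalks i) (hP₃ : P₃ ∈ rightWalks r)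
    (hP₃' : P₃' ∈ rightWalks r')
    (h : P₂ ++ (P₃.map (A P₂)).drop 2 = P₂' ++ (P₃'.map (A P₂')).drop 2) :
    P₂ = P₂' ∧ P₃ = P₃' := by
  obtain ⟨rfl, h2⟩ := kpCount_prefix_eq hP₂ hP₂' h
  exact ⟨rfl, kpCount_piece₂_eq (kpCount_isMidWalk hP₃) (kpCount_isMidWalk hP₃') _ h2⟩

/-- **Valid first scales are renewal times of the first piece**: two pre-images of the same glued
list with first scales `k' ≤ k` force `crossCount k' γ₁ = 1` for the first piece `γ₁` at scale `k`
(the placed second and third pieces of the other pre-image live at slanted levels `≥ k' + 1`;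
`kpCount_crossCount_eq_one`). [cite: KrachunPanagiotis2026, proof of Lemma 3.3 ("at most max_k M_k choices for γ₁")] -/
theorem kpCountB_ren₁ {A : List HV → hvGraph ≃g hvGraph} {k k' : ℕ} {V V' : Finset HV}
    {P₁ P₁' P₂ P₂' P₃ P₃' : List HV}
    (hP₁ : P₁ ∈ rightWalks k) (hP₁' : P₁' ∈ rightWalks k') (hP₂ : P₂ ∈ midWalks V)
    (hP₂' : P₂' ∈ midWalks V')
    (hs : ∀ v ∈ (P₂'.map (A P₁')).drop 2 ++ ((P₃'.map (A P₂')).map (A P₁')).drop 2,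
      (k' : ℤ) + 1 ≤ slev v)
    (h : P₁ ++ (P₂.map (A P₁)).drop 2 ++ ((P₃.map (A P₂)).map (A P₁)).drop 2 =
      P₁' ++ (P₂'.map (A P₁')).drop 2 ++ ((P₃'.map (A P₂')).map (A P₁')).drop 2)
    (hk : k' ≤ k) : crossCount (k' : ℤ) P₁ = 1 := by
  rw [← kpCountB_sig_map_drop hP₂'] at hs
  rw [kpCountB_glue_eq hP₂, kpCountB_glue_eq hP₂'] at h
  exact kpCount_crossCount_eq_one hP₁ hP₁' hs h hk

/-- **Registered helper theorem `stub_kp_countB_cuts`** (crux item stmt-CriticalPhenomena-0808,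
line `root-locality-replaces-loewner`, helper of `stub_kp_countB`): for concatenations
`P ++ R = P' ++ R'` with `P ∈ rightWalks k`, `P' ∈ rightWalks k'` — (1) if `k' ≤ k` and `R'` lives
at slanted levels `≥ k' + 1` then `k'` is a renewal time of `P` (applied at level `i` to
`σ = γ₂ ++ (ψ γ₃).drop 2`: "at most `max_i M_i` choices for `γ₂`"); (2) if `k' = k` then `P = P'`
and `R = R'`.  Both are the Lemma 3.2 facts of `…KPCountA.lean`.
[cite: KrachunPanagiotis2026, proof of Lemma 3.2–3.3 (the pre-images correspond to renewal times)] -/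
theorem stub_kp_countB_cuts : (∀ (k k' : ℕ) (P P' R R' : List Literature.Probability.RandomPlanarGeometry.SAW.HV), P ∈ rightWalks k → P' ∈ rightWalks k' → (∀ v ∈ R', (k' : ℤ) + 1 ≤ slev v) → P ++ R = P' ++ R' → k' ≤ k → crossCount (k' : ℤ) P = 1) ∧ (∀ (k : ℕ) (P P' R R' : List Literature.Probability.RandomPlanarGeometry.SAW.HV), P ∈ rightWalks k → P' ∈ rightWalks k → P ++ R = P' ++ R' → P = P' ∧ R = R') :=
  ⟨fun _ _ _ _ _ _ hP hP' hR' h hk => kpCount_crossCount_eq_one hP hP' hR' h hk,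
    fun _ _ _ _ _ hP hP' h => kpCount_prefix_eq hP hP' h⟩

end Summit.CriticalPhenomena.SAWScalingLimit.Theorems.HexConjecture.RootLocality

end
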